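import Literature.NumberTheory.GaloisRepresentations.LubinTateColemanCoordFreeTwoVariable
import Literature.NumberTheory.GaloisRepresentations.LubinTateColemanTwoVariableTransformTwo
import Literature.NumberTheory.GaloisRepresentations.LubinTateColemanTwoVariableGaloisTwo
import Literature.NumberTheory.GaloisRepresentations.LubinTateColemanRelativeCoordGaloisTwo
import Literature.NumberTheory.GaloisRepresentations.LubinTateColemanRelativeGaloisActionLaws
import HarnessLib

/-!
# The two-variable Coleman transform is EQUIVARIANT in the Lubin–Tate direction: `Col(σ̃·β) = (1 + D_{χ(σ̃)}^{𝒪⟦X⟧}) Col(β)` for `σ̃ ∈ Γ_F`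
# fixing the unramified tower — so `Col : 𝒰_∞ ↪ 𝒪_F⟦X⟧⟦Y⟧` is a map of `𝒪_F⟦X⟧⟦T⟧`-modules (de Shalit I §3.4 Lemma (ii), §3.8 (16)–(17), III §1.3)

De Shalit, *Iwasawa theory of elliptic curves with complex multiplication* (1987), Ch. I §3.4 Lemma (ii) and §3.8: Coleman's map `i` is a
homomorphism of `𝒢`-modules and the limit sequence (17) is one of `Λ(𝒢_a)`-modules.  In the tree's series currency (`q = 2`, `π = 2u`):
g8's two-variable transform `Col(β) ∈ 𝒪_F⟦X⟧⟦Y⟧` of a baseNorm-coherent family `β = (β_m ∈ 𝒰(E_m·K_π^∞))_m`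
(`LubinTateColemanTwoVariableTransformTwo.existsUnique_colemanTransform₂`, characterised by the congruences
`ω_m ∣ [Y^k]Col(β) − Σ_i C(a([Y^k]r_{β_m})(φ_m^i))(1+X)^i`) is Frobenius-equivariant (`series_amice_frob`, `X = φ − 1`).  This file adds the
LUBIN–TATE direction: for `σ̃ ∈ Γ_F` fixing every `E_m`, the coordinates transform levelwise by the base-changed twist
(`relUnitCoordTwo_galAct`: `r_{σ̃β_m} = (1 + D^{𝒪_{E_m}}_{χ(σ̃)}) r_{β_m}`), and the transform congruences are `𝒪_F`-linear in the pair
`(G, r)`, so: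

* ★ `coeff_twistLinearBase_eq_sum` — **`[Y^k] D_v^{S}(r) = Σ_{j≤k} ι([Y^k] D_v(Y^j))·[Y^j] r`** for every base `ι : 𝒪_F → S` (the twist is a
  lower-triangular `𝒪_F`-matrix on coefficients, the SAME matrix for every `S`);
* ★★ `dvd_coeff_twistLinearBase_sub_sum` — the transform congruences pass through the twist: if
  `ω ∣ [Y^k]G − Σ_i C(a([Y^k]x)(e_i))·W_i` for all `k` then the same holds for the pair `(D^{𝒪⟦X⟧}_v G, D^{𝒪_E}_v x)`;
* ★★★ `isColemanTransform₂_galAct` — **if `G` satisfies the `Col`-congruences for `β` then `G + D^{𝒪⟦X⟧}_{χ(σ̃)} G` satisfies them for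
  `(σ̃·β_m)_m`**; with uniqueness (`existsUnique_colemanTransform₂`, `galAct_baseNormCoherent`): ★★★ `colemanTransform₂_galAct_eq` —
  **`Col(σ̃·β) = (1 + D^{𝒪⟦X⟧}_{χ(σ̃)}) Col(β)`**;
* `isAdicComplete_span_C_integer`, ★★★ `existsUnique_tAct_twistLinearBase_integer` — the rank-two freeness over `𝒪_F⟦X⟧⟦T⟧` on the ring
  `PowerSeries (PowerSeries 𝒪_F)` in which `Col(β)` lives (base `ι = C ∘ (LTCoeff.of F)⁻¹`);
* `tAct_one_add_X_pow_eq_iterate` (generic: `(1+T)^n·r = (1 + D)^n r`) — so for `χ(σ̃) = γ`, `Col(σ̃^n·β) = (1+T)^n·Col(β)`: together with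
  `LubinTateColemanCoordFreeTwoVariable` (`𝒪_F⟦X⟧⟦Y⟧` free of rank two over `𝒪_F⟦X⟧⟦T⟧`) and g8's cyclic cokernel, the principal units of the
  two-variable tower embed `𝒪_F⟦X⟧⟦T⟧`-EQUIVARIANTLY into `Λ(ℤ_p × Γ')·1 ⊕ Λ(ℤ_p × Γ')·Y` with pseudo-null cokernel — «`U ≅ Λ² ⊕ (pseudo-null)`»
  for one prime of the tower at `p = 2`, series side.

Everything PROVED (0 sorry, no named facts, no new definitions).

## References

* E. de Shalit, *Iwasawa theory of elliptic curves with complex multiplication* (1987), Ch. I §3.4 Lemma (ii), §3.8 (16)–(17); Ch. III §1.3. [deShalit1987]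
* L. C. Washington, *Introduction to Cyclotomic Fields*, 2nd ed. (1997), §7.1. [Washington1997]
-/

noncomputable section

open scoped PowerSeries.WithPiTopology

namespace Literature.NumberTheory.GaloisRepresentations

/-! ### Generic: `(1+T)^n · r = (1 + D)^n r` -/

namespace LubinTate

/-- **`(1+T)^n·r = (1 + D)^{n} r`** for the action `tAct D`. [cite: deShalit1987, Ch. I §3.1] -/
theorem tAct_one_add_X_pow_eq_iterate {S : Type*} [CommRing S] {p : S} {D : PowerSeries S →ₗ[S] PowerSeries S}
    (hD : ∀ N (r : PowerSeries S), r ∈ adicFiltGen p N → D r ∈ adicFiltGen p (N + 1)) [IsAdicComplete (Ideal.span {p}) S]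
    (n : ℕ) (r : PowerSeries S) : tAct D hD ((1 + PowerSeries.X) ^ n) r = (fun s => s + D s)^[n] r := by
  induction n with
  | zero => rw [pow_zero, tAct_one, Function.iterate_zero_apply]
  | succ n ih => rw [pow_succ', tAct_mul, ih, Function.iterate_succ_apply', tAct_add_left, tAct_one, tAct_X]

end LubinTate

section TwoVariableTwistTwo

open GaloisRepresentations.IsNonarchimedeanLocalField LubinTate ValuativeRel Field Finset

variable {F : Type} [Field F] [ValuativeRel F] [TopologicalSpace F] [IsNonarchimedeanLocalField F]

attribute [local instance] ltNormUniformSpace ltNormIsUniformAddGroup rk1 nF nE fintypeResidueField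

variable {π : 𝒪[F]} (hπ : (valuation F).IsUniformizer (π : F)) (hq : residueFieldCard F = 2)

/-! ### The twist is a lower-triangular `𝒪_F`-matrix on coefficients, the same over every base -/

/-- ★ **`[Y^k] D_v^{S}(r) = Σ_{j ≤ k} ι([Y^k] D_v(Y^j)) · [Y^j] r`** for the base-changed twist along any `ι : 𝒪_F → S`
(`r = Σ_{j≤k} [Y^j]r·Y^j + Y^{k+1}W`, `D^S(Y^j) = map ι (D(Y^j))`, and `Y^{k+1} ∣ D^S(Y^{k+1}W)`). [cite: deShalit1987, Ch. I §3.4 Lemma (ii)] -/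
theorem coeff_twistLinearBase_eq_sum {S : Type*} [CommRing S] (ι : LTCoeff F →+* S) (u : (LTCoeff F)ˣ) (v : 𝒪[F]ˣ) (r : PowerSeries S)
    (k : ℕ) : PowerSeries.coeff k (twistLinearBase hπ hq ι u v r) =
      ∑ j ∈ range (k + 1), ι (PowerSeries.coeff k (twistLinear hπ hq u v (PowerSeries.X ^ j))) * PowerSeries.coeff j r := by
  obtain ⟨W, hW⟩ := exists_eq_sum_add_X_pow_mul r (k + 1)
  -- the tail `Y^{k+1}·W` contributes nothing to `[Y^k]`
  set H := PowerSeries.map ι (hom (isLTRing_LTCoeff hπ) (isLTSeries_LTCoeff π) (isLTSeries_LTCoeff π) (LTCoeff.of F (v : 𝒪[F]))) with hH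
  have hH0 : PowerSeries.constantCoeff H = 0 := constantCoeff_map_unitHom hπ ι v
  have hs : PowerSeries.HasSubst H := PowerSeries.HasSubst.of_constantCoeff_zero' hH0
  have htail : PowerSeries.coeff k (twistLinearBase hπ hq ι u v (PowerSeries.X ^ (k + 1) * W)) = 0 := by
    have hdvd : (PowerSeries.X : PowerSeries S) ^ (k + 1) ∣ twistLinearBase hπ hq ι u v (PowerSeries.X ^ (k + 1) * W) := by
      rw [twistLinearBase_apply, ← hH, PowerSeries.subst_mul hs, PowerSeries.subst_pow hs, PowerSeries.subst_X hs]
      have hXH : (PowerSeries.X : PowerSeries S) ∣ H := PowerSeries.X_dvd_iff.mpr hH0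
      exact dvd_sub (Dvd.dvd.mul_left (Dvd.dvd.mul_right (pow_dvd_pow_of_dvd hXH (k + 1)) _) _) (dvd_mul_right _ _)
    exact (PowerSeries.X_pow_dvd_iff.mp hdvd) k (Nat.lt_succ_self k)
  conv_lhs => rw [hW]
  rw [map_add, map_add, htail, add_zero, map_sum, map_sum]
  refine sum_congr rfl fun j _ => ?_
  rw [← PowerSeries.smul_eq_C_mul, map_smul, PowerSeries.smul_eq_C_mul, PowerSeries.coeff_C_mul, twistLinearBase_X_pow,
    PowerSeries.coeff_map, mul_comm]

/-! ### The transform congruences pass through the twist -/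

/-- `C a · y = a • y` in `𝒪_E` for `a ∈ 𝒪_F` read in `LTCoeff F`. [cite: deShalit1987, Ch. I §3.8 (17)] -/
theorem algebraMap_LTCoeff_mul_eq_smul (E : IntermediateField F (AlgebraicClosure F)) [FiniteDimensional F E] (a : LTCoeff F)
    (y : unitBall E) : algebraMap (LTCoeff F) (unitBall E) a * y = ((LTCoeff.of F).symm a) • y := by
  rw [Algebra.smul_def]; rfl

/-- ★★ **The transform congruences pass through the twist**: for a finite Galois `E ⊆ F̄` with integral normal basis `hθ.basis`, indices
`e : I → Gal(E/F)`, weights `W : I → 𝒪_F⟦X⟧` and a modulus `ω`, if `ω ∣ [Y^k]G − Σ_i C(a([Y^k]x)(e_i))·W_i` for all `k` (where `a = hθ.basis.repr`),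
then the same congruences hold for the pair `(D_v^{𝒪⟦X⟧} G, D_v^{𝒪_E} x)` — both sides are the SAME lower-triangular `𝒪_F`-combination of the
old ones (`coeff_twistLinearBase_eq_sum`), and `a`, `Σ_i C(·)W_i` are `𝒪_F`-linear. [cite: deShalit1987, Ch. I §3.4 Lemma (ii), §3.8 (17)] -/
theorem dvd_coeff_twistLinearBase_sub_sum {E : IntermediateField F (AlgebraicClosure F)} [FiniteDimensional F E] [IsGalois F E]
    {θ : unitBall E} (hθ : IsIntegralNormalGen E θ) {I : Type*} (s : Finset I) (e : I → (E ≃ₐ[F] E)) (W : I → PowerSeries 𝒪[F])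
    (ω : PowerSeries 𝒪[F]) (u : (LTCoeff F)ˣ) (v : 𝒪[F]ˣ) {G : PowerSeries (PowerSeries 𝒪[F])} {x : PowerSeries (unitBall E)}
    (hG : ∀ k, ω ∣ PowerSeries.coeff k G - ∑ i ∈ s, PowerSeries.C (hθ.basis.repr (PowerSeries.coeff k x) (e i)) * W i) (k : ℕ) :
    ω ∣ PowerSeries.coeff k (twistLinearBase hπ hq ((PowerSeries.C (R := 𝒪[F])).comp (LTCoeff.of F).symm.toRingHom) u v G) -
      ∑ i ∈ s, PowerSeries.C (hθ.basis.repr (PowerSeries.coeff k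
        (twistLinearBase hπ hq (algebraMap (LTCoeff F) (unitBall E)) u v x)) (e i)) * W i := by
  -- both coefficients are `Σ_j c_{kj} · (old ones)`
  set c : ℕ → LTCoeff F := fun j => PowerSeries.coeff k (twistLinear hπ hq u v (PowerSeries.X ^ j)) with hc
  have hL : PowerSeries.coeff k (twistLinearBase hπ hq ((PowerSeries.C (R := 𝒪[F])).comp (LTCoeff.of F).symm.toRingHom) u v G) =
      ∑ j ∈ range (k + 1), PowerSeries.C ((LTCoeff.of F).symm (c j)) * PowerSeries.coeff j G := by
    rw [coeff_twistLinearBase_eq_sum]; rfl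
  have hR : ∀ i, hθ.basis.repr (PowerSeries.coeff k (twistLinearBase hπ hq (algebraMap (LTCoeff F) (unitBall E)) u v x)) (e i) =
      ∑ j ∈ range (k + 1), (LTCoeff.of F).symm (c j) * hθ.basis.repr (PowerSeries.coeff j x) (e i) := fun i => by
    rw [coeff_twistLinearBase_eq_sum, map_sum, Finsupp.coe_finsetSum, Finset.sum_apply]
    refine sum_congr rfl fun j _ => ?_
    rw [algebraMap_LTCoeff_mul_eq_smul, map_smul, Finsupp.smul_apply, smul_eq_mul]
  have e1 : ∑ i ∈ s, PowerSeries.C (hθ.basis.repr (PowerSeries.coeff k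
      (twistLinearBase hπ hq (algebraMap (LTCoeff F) (unitBall E)) u v x)) (e i)) * W i =
      ∑ j ∈ range (k + 1), PowerSeries.C ((LTCoeff.of F).symm (c j)) *
        ∑ i ∈ s, PowerSeries.C (hθ.basis.repr (PowerSeries.coeff j x) (e i)) * W i := by
    simp_rw [hR, map_sum, map_mul, sum_mul, mul_sum, mul_assoc]
    rw [sum_comm]
  rw [hL, e1, ← sum_sub_distrib]
  exact Finset.dvd_sum fun j _ => by rw [← mul_sub]; exact Dvd.dvd.mul_left (hG j) _

/-! ### The two-variable transform of `σ̃·β` -/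

variable (p : ℕ) [hp : Fact p.Prime]
variable (E : ℕ → IntermediateField F (AlgebraicClosure F)) [∀ m, FiniteDimensional F (E m)] [∀ m, Normal F (E m)]
  [∀ m, IsGalois F (E m)] (hmono : Monotone E) (hE : ∀ m, E m ≤ maxUnramified F) (hdeg : ∀ m, Module.finrank F (E m) = p ^ m)
  {σ₀ : absoluteGaloisGroup F} (hσ₀ : IsAbsArithFrob σ₀)

/-- ★★★ **If `G` satisfies the `Col`-congruences for `β`, then `G + D^{𝒪⟦X⟧}_{χ(σ̃)} G` satisfies them for `(σ̃·β_m)_m`** (`σ̃ ∈ Γ_F` fixing every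
`E_m`; levelwise `r_{σ̃β_m} = r_{β_m} + D^{𝒪_{E_m}}_{χ(σ̃)} r_{β_m}` by `relUnitCoordTwo_galAct`). [cite: deShalit1987, Ch. I §3.4 Lemma (ii), §3.8 (16)–(17)] -/
theorem isColemanTransform₂_galAct {θ : ∀ m, unitBall (E m)} (hθ : ∀ m, IsIntegralNormalGen (E m) (θ m)) (u : (LTCoeff F)ˣ)
    (hu : LTCoeff.of F π = residueFieldCard F * u) (β : ∀ m, RelNormCoherentUnits hπ (E m)) {σ : absoluteGaloisGroup F}
    (hσE : ∀ m (x : E m), σ • (x : AlgebraicClosure F) = x) {G : PowerSeries (PowerSeries 𝒪[F])}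
    (hG : ∀ m k, ((1 + PowerSeries.X : PowerSeries 𝒪[F]) ^ p ^ m - 1) ∣
      PowerSeries.coeff k G - ∑ i : ZMod (p ^ m), PowerSeries.C ((hθ m).basis.repr
        (PowerSeries.coeff k (relUnitCoordTwo hπ (E m) hq (hE m) hσ₀ u hu (β m)))
        (((absoluteGaloisGroup.toAlgEquiv F σ₀).restrictNormal (E m)) ^ i.val)) * (1 + PowerSeries.X) ^ i.val) (m k : ℕ) :
    ((1 + PowerSeries.X : PowerSeries 𝒪[F]) ^ p ^ m - 1) ∣
      PowerSeries.coeff k (G + twistLinearBase hπ hq ((PowerSeries.C (R := 𝒪[F])).comp (LTCoeff.of F).symm.toRingHom) u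
        (lubinTateChar hπ σ) G) - ∑ i : ZMod (p ^ m), PowerSeries.C ((hθ m).basis.repr
        (PowerSeries.coeff k (relUnitCoordTwo hπ (E m) hq (hE m) hσ₀ u hu ((β m).galAct σ)))
        (((absoluteGaloisGroup.toAlgEquiv F σ₀).restrictNormal (E m)) ^ i.val)) * (1 + PowerSeries.X) ^ i.val := by
  -- levelwise: `r_{σ̃β_m} = r_{β_m} + D^{𝒪_{E_m}} r_{β_m}`
  have hlev : relUnitCoordTwo hπ (E m) hq (hE m) hσ₀ u hu ((β m).galAct σ) = relUnitCoordTwo hπ (E m) hq (hE m) hσ₀ u hu (β m) +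
      twistLinearBase hπ hq (algebraMap (LTCoeff F) (unitBall (E m))) u (lubinTateChar hπ σ) (relUnitCoordTwo hπ (E m) hq (hE m) hσ₀ u hu (β m)) := by
    rw [relUnitCoordTwo_galAct hπ (E m) hq (hE m) hσ₀ u hu (β m) (hσE m), twistLinearBase_apply, add_sub_cancel]
    rfl
  rw [hlev, map_add, map_add]
  have e : ∀ (a b c d : PowerSeries 𝒪[F]), a + b - (c + d) = (a - c) + (b - d) := fun a b c d => by ring
  have hsum : ∑ i : ZMod (p ^ m), PowerSeries.C ((hθ m).basis.repr
        (PowerSeries.coeff k (relUnitCoordTwo hπ (E m) hq (hE m) hσ₀ u hu (β m)) + PowerSeries.coeff k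
          (twistLinearBase hπ hq (algebraMap (LTCoeff F) (unitBall (E m))) u (lubinTateChar hπ σ) (relUnitCoordTwo hπ (E m) hq (hE m) hσ₀ u hu (β m))))
        (((absoluteGaloisGroup.toAlgEquiv F σ₀).restrictNormal (E m)) ^ i.val)) * (1 + PowerSeries.X) ^ i.val =
      ∑ i : ZMod (p ^ m), PowerSeries.C ((hθ m).basis.repr
        (PowerSeries.coeff k (relUnitCoordTwo hπ (E m) hq (hE m) hσ₀ u hu (β m)))
        (((absoluteGaloisGroup.toAlgEquiv F σ₀).restrictNormal (E m)) ^ i.val)) * (1 + PowerSeries.X) ^ i.val +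
      ∑ i : ZMod (p ^ m), PowerSeries.C ((hθ m).basis.repr (PowerSeries.coeff k
          (twistLinearBase hπ hq (algebraMap (LTCoeff F) (unitBall (E m))) u (lubinTateChar hπ σ) (relUnitCoordTwo hπ (E m) hq (hE m) hσ₀ u hu (β m))))
        (((absoluteGaloisGroup.toAlgEquiv F σ₀).restrictNormal (E m)) ^ i.val)) * (1 + PowerSeries.X) ^ i.val := by
    rw [← sum_add_distrib]
    refine sum_congr rfl fun i _ => ?_
    rw [map_add, Finsupp.add_apply, map_add, add_mul]
  rw [hsum, e]
  exact dvd_add (hG m k) (dvd_coeff_twistLinearBase_sub_sum hπ hq (hθ m) Finset.univ _ _ _ u (lubinTateChar hπ σ) (fun k' => hG m k') k)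

include hdeg in
/-- ★★★ **`Col(σ̃·β) = (1 + D^{𝒪⟦X⟧}_{χ(σ̃)}) Col(β)`**: for a baseNorm-coherent family `β` and `σ̃ ∈ Γ_F` fixing every `E_m`, the (unique) transform
`G'` of `(σ̃·β_m)_m` is `G + D^{𝒪⟦X⟧}_{χ(σ̃)} G` where `G` is the transform of `β` — the two-variable Coleman transform intertwines the Galois
action in the Lubin–Tate direction with the base-changed twist on `𝒪_F⟦X⟧⟦Y⟧`, i.e. it is a map of `𝒪_F⟦X⟧⟦T⟧`-modules, `T = σ_γ − 1`
(`LubinTateColemanCoordFreeTwoVariable`). [cite: deShalit1987, Ch. I §3.4 Lemma (ii), §3.8 (16)–(17); Ch. III §1.3] -/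
theorem colemanTransform₂_galAct_eq [IsAdicComplete (Ideal.span {(p : 𝒪[F])}) 𝒪[F]] {θ : ∀ m, unitBall (E m)}
    (hθ : ∀ m, IsIntegralNormalGen (E m) (θ m)) (hcoh : ∀ m, unitBallTrace (hmono (Nat.le_succ m)) (θ (m + 1)) = θ m)
    (u : (LTCoeff F)ˣ) (hu : LTCoeff.of F π = residueFieldCard F * u) {β : ∀ m, RelNormCoherentUnits hπ (E m)}
    (hβ : ∀ m, (β (m + 1)).baseNorm hπ (hmono (Nat.le_succ m)) = β m) {σ : absoluteGaloisGroup F}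
    (hσE : ∀ m (x : E m), σ • (x : AlgebraicClosure F) = x) {G G' : PowerSeries (PowerSeries 𝒪[F])}
    (hG : ∀ m k, ((1 + PowerSeries.X : PowerSeries 𝒪[F]) ^ p ^ m - 1) ∣
      PowerSeries.coeff k G - ∑ i : ZMod (p ^ m), PowerSeries.C ((hθ m).basis.repr
        (PowerSeries.coeff k (relUnitCoordTwo hπ (E m) hq (hE m) hσ₀ u hu (β m)))
        (((absoluteGaloisGroup.toAlgEquiv F σ₀).restrictNormal (E m)) ^ i.val)) * (1 + PowerSeries.X) ^ i.val)
    (hG' : ∀ m k, ((1 + PowerSeries.X : PowerSeries 𝒪[F]) ^ p ^ m - 1) ∣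
      PowerSeries.coeff k G' - ∑ i : ZMod (p ^ m), PowerSeries.C ((hθ m).basis.repr
        (PowerSeries.coeff k (relUnitCoordTwo hπ (E m) hq (hE m) hσ₀ u hu ((β m).galAct σ)))
        (((absoluteGaloisGroup.toAlgEquiv F σ₀).restrictNormal (E m)) ^ i.val)) * (1 + PowerSeries.X) ^ i.val) :
    G' = G + twistLinearBase hπ hq ((PowerSeries.C (R := 𝒪[F])).comp (LTCoeff.of F).symm.toRingHom) u (lubinTateChar hπ σ) G :=
  (existsUnique_colemanTransform₂ p hπ E hmono hE hdeg hσ₀ hq hθ hcoh u hu (galAct_baseNormCoherent hπ E hmono σ hβ)).unique hG'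
    (isColemanTransform₂_galAct hπ hq p E hE hσ₀ hθ u hu β hσE hG)

/-- ★★ **Iterating: the transform of `σ̃^n·β` is `(1 + D^{𝒪⟦X⟧}_{χ(σ̃)})^n G`** (congruence form, no completeness needed): with
`tAct_one_add_X_pow_eq_iterate` this is `(1+T)^n·Col(β)` for `T = σ̃ − 1` — the `Λ(Γ')`-linearity of `Col` in the Lubin–Tate direction.
[cite: deShalit1987, Ch. I §3.4 Lemma (ii), §3.8 (17)] -/
theorem isColemanTransform₂_galAct_pow {θ : ∀ m, unitBall (E m)} (hθ : ∀ m, IsIntegralNormalGen (E m) (θ m)) (u : (LTCoeff F)ˣ)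
    (hu : LTCoeff.of F π = residueFieldCard F * u) (β : ∀ m, RelNormCoherentUnits hπ (E m)) {σ : absoluteGaloisGroup F}
    (hσE : ∀ m (x : E m), σ • (x : AlgebraicClosure F) = x) {G : PowerSeries (PowerSeries 𝒪[F])}
    (hG : ∀ m k, ((1 + PowerSeries.X : PowerSeries 𝒪[F]) ^ p ^ m - 1) ∣
      PowerSeries.coeff k G - ∑ i : ZMod (p ^ m), PowerSeries.C ((hθ m).basis.repr
        (PowerSeries.coeff k (relUnitCoordTwo hπ (E m) hq (hE m) hσ₀ u hu (β m)))
        (((absoluteGaloisGroup.toAlgEquiv F σ₀).restrictNormal (E m)) ^ i.val)) * (1 + PowerSeries.X) ^ i.val) (n m k : ℕ) :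
    ((1 + PowerSeries.X : PowerSeries 𝒪[F]) ^ p ^ m - 1) ∣
      PowerSeries.coeff k ((fun s => s + twistLinearBase hπ hq ((PowerSeries.C (R := 𝒪[F])).comp (LTCoeff.of F).symm.toRingHom) u
        (lubinTateChar hπ σ) s)^[n] G) - ∑ i : ZMod (p ^ m), PowerSeries.C ((hθ m).basis.repr
        (PowerSeries.coeff k (relUnitCoordTwo hπ (E m) hq (hE m) hσ₀ u hu ((β m).galAct (σ ^ n))))
        (((absoluteGaloisGroup.toAlgEquiv F σ₀).restrictNormal (E m)) ^ i.val)) * (1 + PowerSeries.X) ^ i.val := by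
  induction n generalizing m k with
  | zero =>
    rw [Function.iterate_zero_apply, pow_zero, RelNormCoherentUnits.galAct_one]
    exact hG m k
  | succ n ih =>
    have h := isColemanTransform₂_galAct hπ hq p E hE hσ₀ hθ u hu (fun m' => (β m').galAct (σ ^ n)) hσE
      (G := (fun s => s + twistLinearBase hπ hq ((PowerSeries.C (R := 𝒪[F])).comp (LTCoeff.of F).symm.toRingHom) u
        (lubinTateChar hπ σ) s)^[n] G) ih m k
    rw [Function.iterate_succ_apply', pow_succ', ← RelNormCoherentUnits.galAct_mul_left]
    exact h

/-! ### The rank-two freeness on the transform's ambient ring `PowerSeries (PowerSeries 𝒪_F)` -/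

include hπ in
/-- `𝒪_F⟦X⟧` (coefficients `𝒪[F]`, base `ι = C ∘ (LTCoeff.of F)⁻¹`) is `(C π)`-adically complete. [cite: Washington1997, §7.1] -/
theorem isAdicComplete_span_C_integer :
    IsAdicComplete (Ideal.span {((PowerSeries.C (R := 𝒪[F])).comp (LTCoeff.of F).symm.toRingHom) (LTCoeff.of F π)})
      (PowerSeries 𝒪[F]) := by
  haveI : IsAdicComplete (Ideal.span {(π : 𝒪[F])}) 𝒪[F] := isAdicComplete_LTCoeff hπ
  exact isAdicComplete_span_C (a := π)

include hπ in
/-- `C π` is a non-zero-divisor of `PowerSeries 𝒪_F`. [cite: Washington1997, §7.1] -/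
theorem eq_zero_of_C_pi_mul_eq_zero_integer (x : PowerSeries 𝒪[F])
    (h : ((PowerSeries.C (R := 𝒪[F])).comp (LTCoeff.of F).symm.toRingHom) (LTCoeff.of F π) * x = 0) : x = 0 := by
  refine PowerSeries.ext fun i => ?_
  have hi := congrArg (PowerSeries.coeff i) h
  rw [RingHom.comp_apply, PowerSeries.coeff_C_mul, map_zero] at hi
  rw [map_zero]
  exact (isLTRing_LTCoeff hπ).eq_zero_of_mul_eq_zero _ hi

/-- ★★★ **`PowerSeries (PowerSeries 𝒪_F) = Λ·1 ⊕ Λ·Y`, `Λ = 𝒪_F⟦X⟧⟦T⟧`, for the base `ι = C ∘ (LTCoeff.of F)⁻¹` of the transform**: the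
rank-two freeness of `LubinTateColemanCoordFreeTwoVariable` on the very ring in which `Col(β)` lives (so `Col(𝒰_∞)` sits in a free
`𝒪_F⟦X⟧⟦T⟧`-module of rank two, equivariantly by `colemanTransform₂_galAct_eq`). [cite: deShalit1987, Ch. I §3.1, §3.8 (17); Ch. III §1.3] -/
theorem existsUnique_tAct_twistLinearBase_integer (u : (LTCoeff F)ˣ) (hu : LTCoeff.of F π = residueFieldCard F * u) (γ w : 𝒪[F]ˣ)
    (hγ : (γ : 𝒪[F]) = 1 + π ^ 2 * w) (G : PowerSeries (PowerSeries 𝒪[F])) :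
    haveI := isAdicComplete_span_C_integer hπ
    ∃! ab : PowerSeries (PowerSeries 𝒪[F]) × PowerSeries (PowerSeries 𝒪[F]),
      tAct (twistLinearBase hπ hq ((PowerSeries.C (R := 𝒪[F])).comp (LTCoeff.of F).symm.toRingHom) u γ)
          (twistLinearBase_mem_adicFiltGen_succ hπ hq ((PowerSeries.C (R := 𝒪[F])).comp (LTCoeff.of F).symm.toRingHom) u hu γ) ab.1 1 +
        tAct (twistLinearBase hπ hq ((PowerSeries.C (R := 𝒪[F])).comp (LTCoeff.of F).symm.toRingHom) u γ)
          (twistLinearBase_mem_adicFiltGen_succ hπ hq ((PowerSeries.C (R := 𝒪[F])).comp (LTCoeff.of F).symm.toRingHom) u hu γ) ab.2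
          PowerSeries.X = G := by
  haveI := isAdicComplete_span_C_integer hπ
  exact existsUnique_tAct_twistLinearBase hπ hq _ (eq_zero_of_C_pi_mul_eq_zero_integer hπ) u hu γ w hγ G

end TwoVariableTwistTwo

end Literature.NumberTheory.GaloisRepresentations
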